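import Summits.KontsevichZagierPeriods.KontsevichZagierPeriods.Theorems.HurwitzMicroSectorsNormalFormPrincipleM4SimplexFacts

/-!
# `NormalFormPrinciple` (stmt-KontsevichZagierPeriods-3869), line `SketchIdeator1` —
# leaf `stub_boxRigidity`, layer `M4` toolkit: the dilation moves `t ↦ t²` on `Δ₄` and `Δ₂`

Pure proof file (registered sub-goal `m4_dilation_moves` of stmt-KontsevichZagierPeriods-3869, line
`SketchIdeator1`, lead seat c9; layer `M4` toolkit = the dimension-four campaign of the leaf
`stub_boxRigidity`; `--supports` the crux). The distribution relations of polylogarithms at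
level `2` are, in the Kontsevich–Zagier calculus, ONE change of variables (rule (2),
`KZ.changeOfVariablesRel`): the dilation

  `Φ(t) = (tⱼ²)ⱼ`,   `DΦ(t) = diag(2tⱼ)ⱼ`,   `|det DΦ(t)| = ∏ⱼ 2tⱼ`,

of the decreasing open simplex `Δₙ = {1 > t₀ > t₁ > ⋯ > tₙ₋₁ > 0} = KZ.openOrderedSimplex n`
onto itself (squaring is an increasing bijection of `(0,1)`, inverse `√`; `Φ` is a
`ℚ`-polynomial, hence `ℚ`-semialgebraic, map). The chart is built once for every dimension `n`
(`m4d_hasFDerivAt_dilMap`, `m4d_abs_det_dilDeriv`, `m4d_injOn_dilMap`, `m4d_image_dilMap`,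
`m4d_isSemialgebraicMapOn_dilMap`) and the generic move `m4d_dilation_of_eq` states: for a GIVEN
representation `T` on `Δₙ` and any function `F` agreeing with `T.integrand (Φ s) · ∏ⱼ 2sⱼ` on
`Δₙ`, (1) every representation `N` on `Δₙ` whose integrand agrees with `F` on `Δₙ` satisfies
`[N] − [T] ∈ KZ.changeOfVariablesRel ⊆ KZ.relations` (source `N`, image `T`); (2) such an `N`
with integrand LITERALLY `F` exists — `F` is `ℚ`-semialgebraic on `Δₙ` as the composite of
`T.integrand` with the semialgebraic chart (`IsSemialgebraicFunOn.comp_isSemialgebraicMapOn_holds`)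
times the polynomial Jacobian, and absolutely integrable on `Δₙ` by Mathlib's Jacobian criterion
(`MeasureTheory.integrableOn_image_iff_integrableOn_abs_det_fderiv_smul`) applied to
`T.integrableOn` on `Φ '' Δₙ = Δₙ`.

The registered statement is the pair of instances `n = 4` (word `T = [Δ₄, x(t₀) y(t₁) z(t₂) w(t₃)]`,
pulled-back integrand `(x(s₀²)·2s₀)(y(s₁²)·2s₁)(z(s₂²)·2s₂)(w(s₃²)·2s₃)`, Jacobian `16 s₀s₁s₂s₃`)
and `n = 2` (word `T = [Δ₂, x(t₀) y(t₁)]`, pulled-back integrand `(x(s₀²)·2s₀)(y(s₁²)·2s₁)`,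
Jacobian `4 s₀s₁`), read on the literal set-builder domains via
`m4s_simplex4_eq_openOrderedSimplex` and `m4d_simplex2_eq_openOrderedSimplex`.

Pattern of `M3.l2w3_dilation_move` (the same chart in dimension three) and of
`OctahedralSymmetry.OctahedralInvolutionMove.abs_det_octDeriv` (diagonal Jacobian in every
dimension).

References: M. Kontsevich, D. Zagier, *Periods* (2001), §1.1–1.2, rule (2). No definitions are
introduced.
-/

noncomputable section

open MeasureTheory Set
open Literature.NumberTheory.Transcendental Literature.NumberTheory.Transcendental.KZ
open Literature.ModelTheory.ExponentialFields (IsSemialgebraic)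

namespace Summit.KontsevichZagierPeriods.HurwitzMicroSectors.NormalFormPrinciple.PiBox.M3

/-! ## The dilation chart `Φ(t)ⱼ = tⱼ²` of the open ordered simplex, every dimension -/

variable {n : ℕ}

/-- **The Jacobian.** The derivative of the dilation is packaged as the continuous linear map of
the matrix `diag(2tⱼ)ⱼ`, so `|det DΦ(t)| = |∏ⱼ 2tⱼ|` (`Matrix.det_diagonal`). [folklore] -/
theorem m4d_abs_det_dilDeriv (t : Fin n → ℝ) :
    |(LinearMap.toContinuousLinearMap
        (Matrix.toLin' (Matrix.diagonal fun k : Fin n => 2 * t k))).det| = |∏ k, 2 * t k| := by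
  change |LinearMap.det (Matrix.toLin' (Matrix.diagonal fun k : Fin n => 2 * t k))| = _
  rw [LinearMap.det_toLin', Matrix.det_diagonal]

/-- The dilation `t ↦ (tⱼ²)ⱼ` is differentiable everywhere with derivative the linear map of
`diag(2tⱼ)ⱼ` (coordinatewise `d(sⱼ·sⱼ) = 2tⱼ dsⱼ`). [folklore] -/
theorem m4d_hasFDerivAt_dilMap (t : Fin n → ℝ) :
    HasFDerivAt (fun (s : Fin n → ℝ) (j : Fin n) => s j ^ 2)
      (LinearMap.toContinuousLinearMap
        (Matrix.toLin' (Matrix.diagonal fun k : Fin n => 2 * t k))) t := by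
  rw [hasFDerivAt_pi']
  intro j
  have h0 : HasFDerivAt (fun s : Fin n → ℝ => s j)
      (ContinuousLinearMap.proj (R := ℝ) (φ := fun _ : Fin n => ℝ) j) t := hasFDerivAt_apply j t
  have e : (fun s : Fin n → ℝ => s j ^ 2) = fun s => s j * s j := funext fun s => sq (s j)
  show HasFDerivAt (fun s : Fin n → ℝ => s j ^ 2) _ t
  rw [e]
  refine (h0.mul h0).congr_fderiv (ContinuousLinearMap.ext fun v => ?_)
  show t j * v j + t j * v j = Matrix.toLin' (Matrix.diagonal fun k : Fin n => 2 * t k) v j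
  rw [Matrix.toLin'_apply, Matrix.mulVec_diagonal]
  ring

/-- The dilation is injective on the open ordered simplex (squares of positive reals). [folklore] -/
theorem m4d_injOn_dilMap :
    InjOn (fun (s : Fin n → ℝ) (j : Fin n) => s j ^ 2) (openOrderedSimplex n) := by
  intro t ht s hs hts
  funext j
  have e : t j ^ 2 = s j ^ 2 := congr_fun hts j
  exact (pow_left_inj₀ (ht.1 j).le (hs.1 j).le two_ne_zero).1 e

/-- The dilation maps the open ordered simplex into itself (squaring is increasing on the
positive reals and preserves `(0,1)`). [folklore] -/
theorem m4d_mapsTo_dilMap :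
    MapsTo (fun (s : Fin n → ℝ) (j : Fin n) => s j ^ 2) (openOrderedSimplex n)
      (openOrderedSimplex n) := by
  rintro t ⟨h0, h1, hanti⟩
  exact ⟨fun j => pow_pos (h0 j) 2, fun j => pow_lt_one₀ (h0 j).le (h1 j) two_ne_zero,
    fun i j hij => pow_lt_pow_left₀ (hanti hij) (h0 j).le two_ne_zero⟩

/-- The dilation maps the open ordered simplex ONTO itself (inverse `(√uⱼ)ⱼ`, and `√` is
increasing and preserves `(0,1)`). [folklore] -/
theorem m4d_image_dilMap :
    (fun (s : Fin n → ℝ) (j : Fin n) => s j ^ 2) '' openOrderedSimplex n =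
      openOrderedSimplex n := by
  refine m4d_mapsTo_dilMap.image_subset.antisymm fun u hu => ?_
  obtain ⟨h0, h1, hanti⟩ := hu
  refine ⟨fun j => Real.sqrt (u j), ⟨fun j => Real.sqrt_pos.2 (h0 j), fun j => ?_,
    fun i j hij => Real.sqrt_lt_sqrt (h0 j).le (hanti hij)⟩, funext fun j => Real.sq_sqrt (h0 j).le⟩
  have h := Real.sqrt_lt_sqrt (h0 j).le (h1 j)
  rwa [Real.sqrt_one] at h

/-- The dilation is a `ℚ`-polynomial, hence `ℚ`-semialgebraic, map on every `ℚ`-semialgebraic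
set. [folklore] -/
theorem m4d_isSemialgebraicMapOn_dilMap {s : Set (Fin n → ℝ)} (hs : IsSemialgebraic ℚ s) :
    IsSemialgebraicMapOn ℚ s (fun (s : Fin n → ℝ) (j : Fin n) => s j ^ 2) := by
  convert isSemialgebraicMapOn_aeval hs
    (fun j => (MvPolynomial.X j ^ 2 : MvPolynomial (Fin n) ℚ)) using 2 with x
  funext j
  simp

/-! ## The generic dilation move on the open ordered simplex -/

/-- **The dilation move in dimension `n` (rule 2).** Let `T` be a representation on
`D = KZ.openOrderedSimplex n` and let `F` agree on `D` with the pull-back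
`T.integrand (sⱼ²)ⱼ · ∏ⱼ 2sⱼ = T.integrand (Φ s) · |det DΦ(s)|`. Then (1) for every representation
`N` on `D` whose integrand agrees with `F` on `D`, `[N] − [T]` is ONE change-of-variables move
along the dilation chart (source `N`, image `T`), hence lies in `KZ.relations`; (2) a
representation on `D` with integrand `F` exists: `F` is `ℚ`-semialgebraic on `D` (composite of
`T.integrand` with the semialgebraic chart, times the polynomial Jacobian) and absolutely
integrable on `D` (Jacobian criterion applied to `T.integrableOn` on `Φ '' D = D`).
[cite: KontsevichZagier2001, §1.2 rule (2)] -/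
theorem m4d_dilation_of_eq {D : Set (Fin n → ℝ)} (hD : D = openOrderedSimplex n)
    (T : IntegralRep n) (F : (Fin n → ℝ) → ℝ) (hTd : T.domain = D)
    (hF : ∀ s ∈ T.domain, (fun j : Fin n => s j ^ 2) ∈ T.domain →
      T.integrand (fun j => s j ^ 2) * ∏ k, 2 * s k = F s) :
    (∀ N : IntegralRep n, N.domain = D → EqOn N.integrand F N.domain → of N - of T ∈ relations) ∧
    (∃ N : IntegralRep n, N.domain = D ∧ N.integrand = F) := by
  subst hD
  set Φ : (Fin n → ℝ) → (Fin n → ℝ) := fun s j => s j ^ 2 with hΦ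
  set Φ' : (Fin n → ℝ) → (Fin n → ℝ) →L[ℝ] (Fin n → ℝ) := fun t =>
    LinearMap.toContinuousLinearMap (Matrix.toLin' (Matrix.diagonal fun k : Fin n => 2 * t k))
    with hΦ'
  have hderiv : ∀ t, HasFDerivAt Φ (Φ' t) t := fun t => m4d_hasFDerivAt_dilMap t
  -- the chart data transported to `T.domain = Δₙ`
  have hsaT : IsSemialgebraicMapOn ℚ T.domain Φ :=
    m4d_isSemialgebraicMapOn_dilMap T.isSemialgebraic_domain
  have hinjT : InjOn Φ T.domain := by rw [hTd]; exact m4d_injOn_dilMap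
  have himageT : Φ '' T.domain = T.domain := by rw [hTd]; exact m4d_image_dilMap
  have hmeasT : MeasurableSet T.domain := by rw [hTd]; exact measurableSet_openOrderedSimplex n
  have hmaps : MapsTo Φ T.domain T.domain := by rw [hTd]; exact m4d_mapsTo_dilMap
  have hdetT : ∀ s ∈ T.domain, |(Φ' s).det| = ∏ k, 2 * s k := by
    intro s hs
    rw [hTd] at hs
    rw [hΦ', m4d_abs_det_dilDeriv]
    exact abs_of_pos (Finset.prod_pos fun k _ => mul_pos two_pos (hs.1 k))
  -- the pull-back identity on `Δₙ`, Jacobian included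
  have hpull : ∀ s ∈ T.domain, T.integrand (Φ s) * |(Φ' s).det| = F s := by
    intro s hs
    rw [hdetT s hs]
    exact hF s hs (hmaps hs)
  refine ⟨fun N hNd hNi => ?_, ?_⟩
  · -- (1) one change-of-variables move, source `N`, image `T`
    have hNT : N.domain = T.domain := hNd.trans hTd.symm
    have himage' : T.domain = Φ '' N.domain := by rw [hNT, himageT]
    have hsaN : IsSemialgebraicMapOn ℚ N.domain Φ := by rw [hNT]; exact hsaT
    have hinjN : InjOn Φ N.domain := by rw [hNT]; exact hinjT
    refine changeOfVariablesRel_subset_relations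
      ⟨n, N, T, Φ, Φ', hsaN, fun s _ => (hderiv s).hasFDerivWithinAt, hinjN, himage',
        fun s hs => ?_, rfl⟩
    rw [hNi hs, hpull s (hNT ▸ hs)]
  · -- (2) existence of the pulled-back representation on `Δₙ`
    have hcomp : IsSemialgebraicFunOn ℚ T.domain (T.integrand ∘ Φ) :=
      IsSemialgebraicFunOn.comp_isSemialgebraicMapOn_holds T.isSemialgebraicFunOn_integrand hsaT
        hmaps
    have hjac : IsSemialgebraicFunOn ℚ T.domain (fun s => |(Φ' s).det|) := by
      refine (isSemialgebraicFunOn_aeval T.isSemialgebraic_domain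
        (∏ k : Fin n, 2 * MvPolynomial.X k : MvPolynomial (Fin n) ℚ)).congr fun s hs => ?_
      rw [hdetT s hs]
      simp [map_prod]
    have hsaN : IsSemialgebraicFunOn ℚ T.domain F :=
      (IsSemialgebraicFunOn.mul_holds hcomp hjac).congr fun s hs => hpull s hs
    have hint : IntegrableOn F T.domain := by
      have h1 : IntegrableOn T.integrand (Φ '' T.domain) := by rw [himageT]; exact T.integrableOn
      rw [integrableOn_image_iff_integrableOn_abs_det_fderiv_smul volume hmeasT
        (fun s _ => (hderiv s).hasFDerivWithinAt) hinjT] at h1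
      refine h1.congr_fun (fun s hs => ?_) hmeasT
      show |(Φ' s).det| * T.integrand (Φ s) = _
      rw [mul_comm]
      exact hpull s hs
    exact ⟨⟨T.domain, F, T.isSemialgebraic_domain, hsaN, hint⟩, hTd, rfl⟩

/-! ## Dimension two: the decreasing open simplex `Δ₂` -/

/-- The decreasing open simplex of `ℝ²` written with explicit inequalities is Kontsevich's open
ordered simplex `KZ.openOrderedSimplex 2`. [folklore] -/
theorem m4d_simplex2_eq_openOrderedSimplex :
    {t : Fin 2 → ℝ | 0 < t 1 ∧ t 1 < t 0 ∧ t 0 < 1} = openOrderedSimplex 2 := by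
  ext t
  simp only [openOrderedSimplex, mem_setOf_eq]
  constructor
  · rintro ⟨h1, h10, h0⟩
    refine ⟨?_, ?_, ?_⟩
    · intro i
      fin_cases i
      exacts [h1.trans h10, h1]
    · intro i
      fin_cases i
      exacts [h0, h10.trans h0]
    · rw [Fin.strictAnti_iff_succ_lt]
      intro i
      fin_cases i
      exact h10
  · rintro ⟨hpos, hlt, hanti⟩
    exact ⟨hpos 1, hanti (by decide : (0 : Fin 2) < 1), hlt 0⟩

/-! ## The registered sub-goal -/

/-- **Stub `m4_dilation_moves` (registered sub-goal of stmt-KontsevichZagierPeriods-3869, line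
`SketchIdeator1`, layer `M4` toolkit).** Two dilation moves `t ↦ (tⱼ²)ⱼ` (rule 2) of a decreasing
open simplex onto itself applied to a word representation with ARBITRARY letters:
on `Δ₄ = {0 < t₃ < t₂ < t₁ < t₀ < 1}` with `T = [Δ₄, x(t₀) y(t₁) z(t₂) w(t₃)]`, Jacobian
`16 s₀s₁s₂s₃`, pulled-back integrand `(x(s₀²)·2s₀)(y(s₁²)·2s₁)(z(s₂²)·2s₂)(w(s₃²)·2s₃)`; and on
`Δ₂ = {0 < t₁ < t₀ < 1}` with `T = [Δ₂, x(t₀) y(t₁)]`, Jacobian `4 s₀s₁`, pulled-back integrand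
`(x(s₀²)·2s₀)(y(s₁²)·2s₁)`. In each dimension: (1) for every representation `N` on the simplex
carrying the pulled-back integrand there, `[N] − [T]` is ONE change-of-variables move
(`KZ.changeOfVariablesRel ⊆ KZ.relations`); (2) such an `N` exists (semialgebraicity by
composition with the polynomial chart, integrability by the Jacobian criterion along the chart).
Both are `m4d_dilation_of_eq` read on the literal domains.
[cite: KontsevichZagier2001, §1.2 rule (2)] -/
theorem m4_dilation_moves :
    (∀ (x y z w : ℝ → ℝ) (T : IntegralRep 4),
      T.domain = {t | 0 < t 3 ∧ t 3 < t 2 ∧ t 2 < t 1 ∧ t 1 < t 0 ∧ t 0 < 1} →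
      EqOn T.integrand (fun t => x (t 0) * y (t 1) * z (t 2) * w (t 3)) T.domain →
      (∀ N : IntegralRep 4, N.domain = {t | 0 < t 3 ∧ t 3 < t 2 ∧ t 2 < t 1 ∧ t 1 < t 0 ∧ t 0 < 1} →
        EqOn N.integrand (fun s => (x (s 0 ^ 2) * (2 * s 0)) * (y (s 1 ^ 2) * (2 * s 1)) *
          (z (s 2 ^ 2) * (2 * s 2)) * (w (s 3 ^ 2) * (2 * s 3))) N.domain →
        of N - of T ∈ relations) ∧
      (∃ N : IntegralRep 4, N.domain = {t | 0 < t 3 ∧ t 3 < t 2 ∧ t 2 < t 1 ∧ t 1 < t 0 ∧ t 0 < 1} ∧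
        N.integrand = fun s => (x (s 0 ^ 2) * (2 * s 0)) * (y (s 1 ^ 2) * (2 * s 1)) *
          (z (s 2 ^ 2) * (2 * s 2)) * (w (s 3 ^ 2) * (2 * s 3)))) ∧
    (∀ (x y : ℝ → ℝ) (T : IntegralRep 2),
      T.domain = {t | 0 < t 1 ∧ t 1 < t 0 ∧ t 0 < 1} →
      EqOn T.integrand (fun t => x (t 0) * y (t 1)) T.domain →
      (∀ N : IntegralRep 2, N.domain = {t | 0 < t 1 ∧ t 1 < t 0 ∧ t 0 < 1} →
        EqOn N.integrand (fun s => (x (s 0 ^ 2) * (2 * s 0)) * (y (s 1 ^ 2) * (2 * s 1))) N.domain →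
        of N - of T ∈ relations) ∧
      (∃ N : IntegralRep 2, N.domain = {t | 0 < t 1 ∧ t 1 < t 0 ∧ t 0 < 1} ∧
        N.integrand = fun s => (x (s 0 ^ 2) * (2 * s 0)) * (y (s 1 ^ 2) * (2 * s 1)))) := by
  refine ⟨fun x y z w T hTd hTi => m4d_dilation_of_eq m4s_simplex4_eq_openOrderedSimplex T _ hTd
      fun s _ hΦs => ?_,
    fun x y T hTd hTi => m4d_dilation_of_eq m4d_simplex2_eq_openOrderedSimplex T _ hTd
      fun s _ hΦs => ?_⟩
  · rw [hTi hΦs]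
    simp only [Fin.prod_univ_four]
    ring
  · rw [hTi hΦs]
    simp only [Fin.prod_univ_two]
    ring

end Summit.KontsevichZagierPeriods.HurwitzMicroSectors.NormalFormPrinciple.PiBox.M3
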